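import Mathlib.Topology.ContinuousMap.Weierstrass
import Mathlib.Analysis.SpecialFunctions.ExpDeriv
import Mathlib.Analysis.SpecialFunctions.Log.Basic
import Mathlib.Analysis.SpecialFunctions.Integrals.Basic
import Mathlib.MeasureTheory.Integral.IntervalIntegral.FundThmCalculus
import Mathlib.Analysis.Calculus.IteratedDeriv.Lemmas
import Mathlib.Analysis.Calculus.ContDiff.Basic
import HarnessLib

/-!
# Weighted `C²`-approximation of compactly supported functions on `(0,∞)` by exponential polynomials

For a function `g : ℝ → ℂ` of class `C²` vanishing off a compact interval `[X₁, X₂] ⊂ (0, ∞)`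
and every `ε > 0` we construct an **exponential polynomial**
`f(x) = Σ_{k<N} q_k e^{-(k+2)x}/(k+2)²` with
`|f - g| ≤ ε e^{-2x}`, `|f' - g'| ≤ ε e^{-2x}`, `|f'' - g''| ≤ ε e^{-2x}` on `[0, ∞)`
(`exists_expPoly_approx`). This is the Weierstrass approximation theorem (Weierstrass 1885;
Rudin, *Principles*, Thm 7.26 — Mathlib `exists_polynomial_near_of_continuousOn`) applied to
`t ↦ e^{2x}g''(x)`, `t = e^{-x} ∈ [0,1]`, followed by two integrations from `+∞`
(`∫_x^∞ εe^{-2y}dy = εe^{-2x}/2`).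

Purpose (cell `landau-siegel/ls-inputs`, stub V2 = Conrey–Iwaniec 2002 Prop. 3.1 at weight one):
the modular relation (3.4) IS the summation formula (3.11) for the test functions `e^{-px}`, and
this weighted density statement carries it to all `C²` test functions compactly supported in
`(0,∞)`. No definitions: the exponential polynomial, its derivative `-Σ q_k e^{-(k+2)x}/(k+2)` and
second derivative `Σ q_k e^{-(k+2)x}` are written out in the statement.

## References

* K. Weierstrass, *Über die analytische Darstellbarkeit sogenannter willkürlicher Functionen
  einer reellen Veränderlichen*, Sitzungsber. Akad. Berlin (1885).
* W. Rudin, *Principles of Mathematical Analysis*, 3rd ed. (1976), Theorem 7.26.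
-/

noncomputable section

open scoped Topology
open Filter Set MeasureTheory Real Polynomial

namespace Literature.Analysis.FunctionSpaces

/-! ## Calculus of the exponential polynomials -/

/-- `d/dx e^{-ax} = -a e^{-ax}` (complex-valued). [folklore] -/
private theorem hasDerivAt_ofReal_exp_neg_mul (a x : ℝ) :
    HasDerivAt (fun x : ℝ => ((Real.exp (-(a * x)) : ℝ) : ℂ))
      (((-a * Real.exp (-(a * x)) : ℝ) : ℂ)) x := by
  have h1 : HasDerivAt (fun x : ℝ => -(a * x)) (-a) x := by
    have := (hasDerivAt_id x).const_mul (-a)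
    simpa [neg_mul] using this
  have h2 : HasDerivAt (fun x : ℝ => Real.exp (-(a * x))) (Real.exp (-(a * x)) * (-a)) x :=
    (Real.hasDerivAt_exp _).comp x h1
  have h3 := h2.ofReal_comp
  refine h3.congr_deriv ?_
  push_cast
  ring

/-- `((k : ℂ) + 2) ≠ 0`. [folklore] -/
private theorem natCast_add_two_ne_zero (k : ℕ) : ((k : ℂ) + 2) ≠ 0 := by
  have : ((k + 2 : ℕ) : ℂ) ≠ 0 := Nat.cast_ne_zero.mpr (by omega)
  push_cast at this
  exact this

/-- Derivative of `Σ_{k<N} q_k e^{-(k+2)x}/(k+2)²` is `-Σ_{k<N} q_k e^{-(k+2)x}/(k+2)`. [folklore] -/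
private theorem hasDerivAt_expPoly_two (N : ℕ) (q : ℕ → ℂ) (x : ℝ) :
    HasDerivAt
      (fun x : ℝ => ∑ k ∈ Finset.range N,
        q k * ((Real.exp (-(((k : ℝ) + 2) * x)) : ℝ) : ℂ) / ((k : ℂ) + 2) ^ 2)
      (-∑ k ∈ Finset.range N,
        q k * ((Real.exp (-(((k : ℝ) + 2) * x)) : ℝ) : ℂ) / ((k : ℂ) + 2)) x := by
  have h := HasDerivAt.fun_sum (u := Finset.range N)
    (A := fun k (x : ℝ) => q k * ((Real.exp (-(((k : ℝ) + 2) * x)) : ℝ) : ℂ) / ((k : ℂ) + 2) ^ 2)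
    (A' := fun k => q k * (((-((k : ℝ) + 2) * Real.exp (-(((k : ℝ) + 2) * x)) : ℝ) : ℂ)) /
      ((k : ℂ) + 2) ^ 2) (x := x)
    (fun k _ => ((hasDerivAt_ofReal_exp_neg_mul ((k : ℝ) + 2) x).const_mul (q k)).div_const _)
  refine h.congr_deriv ?_
  rw [← Finset.sum_neg_distrib]
  refine Finset.sum_congr rfl fun k _ => ?_
  have hk := natCast_add_two_ne_zero k
  push_cast
  field_simp

/-- Derivative of `-Σ_{k<N} q_k e^{-(k+2)x}/(k+2)` is `Σ_{k<N} q_k e^{-(k+2)x}`. [folklore] -/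
private theorem hasDerivAt_expPoly_one (N : ℕ) (q : ℕ → ℂ) (x : ℝ) :
    HasDerivAt
      (fun x : ℝ => -∑ k ∈ Finset.range N,
        q k * ((Real.exp (-(((k : ℝ) + 2) * x)) : ℝ) : ℂ) / ((k : ℂ) + 2))
      (∑ k ∈ Finset.range N, q k * ((Real.exp (-(((k : ℝ) + 2) * x)) : ℝ) : ℂ)) x := by
  have h := HasDerivAt.fun_sum (u := Finset.range N)
    (A := fun k (x : ℝ) => q k * ((Real.exp (-(((k : ℝ) + 2) * x)) : ℝ) : ℂ) / ((k : ℂ) + 2))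
    (A' := fun k => q k * (((-((k : ℝ) + 2) * Real.exp (-(((k : ℝ) + 2) * x)) : ℝ) : ℂ)) /
      ((k : ℂ) + 2)) (x := x)
    (fun k _ => ((hasDerivAt_ofReal_exp_neg_mul ((k : ℝ) + 2) x).const_mul (q k)).div_const _)
  refine h.neg.congr_deriv ?_
  rw [← Finset.sum_neg_distrib]
  refine Finset.sum_congr rfl fun k _ => ?_
  have hk := natCast_add_two_ne_zero k
  push_cast
  field_simp

/-- The exponential polynomials are continuous. [folklore] -/
private theorem continuous_expPoly_zero (N : ℕ) (q : ℕ → ℂ) :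
    Continuous (fun x : ℝ => ∑ k ∈ Finset.range N,
      q k * ((Real.exp (-(((k : ℝ) + 2) * x)) : ℝ) : ℂ)) := by
  refine continuous_finsetSum _ fun k _ => ?_
  exact continuous_const.mul (Complex.continuous_ofReal.comp (by fun_prop))

/-- `e^{-ax} → 0` as `x → ∞` for `a > 0` (complex-valued, with a constant factor). [folklore] -/
private theorem tendsto_const_mul_ofReal_exp_neg_mul (c : ℂ) {a : ℝ} (ha : 0 < a) :
    Tendsto (fun x : ℝ => c * ((Real.exp (-(a * x)) : ℝ) : ℂ)) atTop (𝓝 0) := by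
  have h1 : Tendsto (fun x : ℝ => Real.exp (-(a * x))) atTop (𝓝 0) := by
    have := Real.tendsto_exp_neg_atTop_nhds_zero.comp (tendsto_id.const_mul_atTop ha)
    simpa [Function.comp_def] using this
  have h2 : Tendsto (fun x : ℝ => ((Real.exp (-(a * x)) : ℝ) : ℂ)) atTop (𝓝 0) := by
    have := (Complex.continuous_ofReal.tendsto 0).comp h1
    simpa [Function.comp_def] using this
  simpa using h2.const_mul c

/-! ## Integration from `+∞` -/

/-- If `D' ` is the derivative of `D`, `‖D'(x)‖ ≤ a e^{-2x}` on `[0,∞)` and `D → 0` at `+∞`, then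
`‖D(x)‖ ≤ (a/2) e^{-2x}` on `[0,∞)` (`D(x) = -∫_x^∞ D'`). [folklore] -/
private theorem norm_le_of_deriv_bound {D D' : ℝ → ℂ} {a : ℝ} (hD : ∀ x, HasDerivAt D (D' x) x)
    (hD'c : Continuous D') (hbound : ∀ x, 0 ≤ x → ‖D' x‖ ≤ a * Real.exp (-(2 * x)))
    (hlim : Tendsto D atTop (𝓝 0)) (x : ℝ) (hx : 0 ≤ x) :
    ‖D x‖ ≤ a / 2 * Real.exp (-(2 * x)) := by
  -- for every `y ≥ x`: `‖D x‖ ≤ ‖D y‖ + (a/2) e^{-2x}`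
  have hstep : ∀ y, x ≤ y → ‖D x‖ ≤ ‖D y‖ + a / 2 * Real.exp (-(2 * x)) := by
    intro y hxy
    have hFTC : ∫ t in x..y, D' t = D y - D x :=
      intervalIntegral.integral_eq_sub_of_hasDerivAt (fun t _ => hD t)
        (hD'c.intervalIntegrable _ _)
    have hprim : ∀ t, HasDerivAt (fun t : ℝ => -(a / 2) * Real.exp (-(2 * t)))
        (a * Real.exp (-(2 * t))) t := by
      intro t
      have h1 : HasDerivAt (fun t : ℝ => -(2 * t)) (-2) t := by
        have := (hasDerivAt_id t).const_mul (-2 : ℝ)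
        simpa [neg_mul] using this
      have h2 := ((Real.hasDerivAt_exp _).comp t h1).const_mul (-(a / 2))
      refine h2.congr_deriv ?_
      ring
    have hexpint : ∫ t in x..y, a * Real.exp (-(2 * t)) =
        -(a / 2) * Real.exp (-(2 * y)) - -(a / 2) * Real.exp (-(2 * x)) :=
      intervalIntegral.integral_eq_sub_of_hasDerivAt (fun t _ => hprim t)
        ((by fun_prop : Continuous fun t : ℝ => a * Real.exp (-(2 * t))).intervalIntegrable _ _)
    have hnorm : ‖∫ t in x..y, D' t‖ ≤ ∫ t in x..y, a * Real.exp (-(2 * t)) := by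
      refine intervalIntegral.norm_integral_le_of_norm_le hxy ?_ ?_
      · exact Filter.Eventually.of_forall fun t ht => hbound t (by linarith [ht.1.le])
      · exact (by fun_prop : Continuous fun t : ℝ => a * Real.exp (-(2 * t))).intervalIntegrable _ _
    have hpos : 0 ≤ a / 2 * Real.exp (-(2 * y)) := by
      have h0 : 0 ≤ a := by
        have := hbound x hx
        have h1 : 0 < Real.exp (-(2 * x)) := Real.exp_pos _
        nlinarith [norm_nonneg (D' x)]
      positivity
    have h3 : ‖D x‖ ≤ ‖D y‖ + ‖D y - D x‖ := by
      calc ‖D x‖ = ‖D y - (D y - D x)‖ := by ring_nf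
        _ ≤ ‖D y‖ + ‖D y - D x‖ := norm_sub_le _ _
    rw [← hFTC] at h3
    linarith
  -- let `y → ∞`
  have hlim' : Tendsto (fun y => ‖D y‖ + a / 2 * Real.exp (-(2 * x))) atTop
      (𝓝 (0 + a / 2 * Real.exp (-(2 * x)))) :=
    ((tendsto_zero_iff_norm_tendsto_zero.mp hlim)).add tendsto_const_nhds
  rw [zero_add] at hlim'
  exact ge_of_tendsto hlim' (Filter.eventually_atTop.mpr ⟨x, hstep⟩)

/-! ## Facts about the test function -/

/-- `g = 0` near every point of the open set `{x > X₂}`. [folklore] -/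
private theorem eventuallyEq_zero_of_gt {g : ℝ → ℂ} {X₁ X₂ : ℝ}
    (hsupp : ∀ x ∉ Set.Icc X₁ X₂, g x = 0) {x : ℝ} (hx : X₂ < x) : g =ᶠ[𝓝 x] fun _ => 0 := by
  filter_upwards [Ioi_mem_nhds hx] with y hy
  exact hsupp y fun h => absurd h.2 (not_le.mpr hy)

/-- `g' = 0` on `{x > X₂}`. [folklore] -/
private theorem deriv_eq_zero_of_gt {g : ℝ → ℂ} {X₁ X₂ : ℝ}
    (hsupp : ∀ x ∉ Set.Icc X₁ X₂, g x = 0) {x : ℝ} (hx : X₂ < x) : deriv g x = 0 := by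
  rw [(eventuallyEq_zero_of_gt hsupp hx).deriv_eq]
  exact deriv_const x 0

/-- `g'' = 0` on `{x > X₂}`. [folklore] -/
private theorem iteratedDeriv_two_eq_zero_of_gt {g : ℝ → ℂ} {X₁ X₂ : ℝ}
    (hsupp : ∀ x ∉ Set.Icc X₁ X₂, g x = 0) {x : ℝ} (hx : X₂ < x) : iteratedDeriv 2 g x = 0 := by
  rw [iteratedDeriv_succ, iteratedDeriv_one]
  have h : deriv g =ᶠ[𝓝 x] fun _ => 0 := by
    filter_upwards [Ioi_mem_nhds hx] with y hy
    exact deriv_eq_zero_of_gt hsupp hy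
  rw [h.deriv_eq]
  exact deriv_const x 0

/-- `g → 0` at `+∞`. [folklore] -/
private theorem tendsto_zero_atTop {g : ℝ → ℂ} {X₁ X₂ : ℝ}
    (hsupp : ∀ x ∉ Set.Icc X₁ X₂, g x = 0) : Tendsto g atTop (𝓝 0) := by
  apply tendsto_const_nhds.congr'
  filter_upwards [eventually_gt_atTop X₂] with y hy
  exact (hsupp y fun h => absurd h.2 (not_le.mpr hy)).symm

/-- `g' → 0` at `+∞`. [folklore] -/
private theorem tendsto_deriv_zero_atTop {g : ℝ → ℂ} {X₁ X₂ : ℝ}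
    (hsupp : ∀ x ∉ Set.Icc X₁ X₂, g x = 0) : Tendsto (deriv g) atTop (𝓝 0) := by
  apply tendsto_const_nhds.congr'
  filter_upwards [eventually_gt_atTop X₂] with y hy
  exact (deriv_eq_zero_of_gt hsupp hy).symm

/-- A `C²` function is differentiable with derivative `g'`. [folklore] -/
private theorem hasDerivAt_g {g : ℝ → ℂ} (hg : ContDiff ℝ 2 g) (x : ℝ) : HasDerivAt g (deriv g x) x :=
  ((hg.differentiable (by norm_num)) x).hasDerivAt

/-- For a `C²` function, `g'` is differentiable with derivative `g'' = iteratedDeriv 2 g`. [folklore] -/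
private theorem hasDerivAt_deriv_g {g : ℝ → ℂ} (hg : ContDiff ℝ 2 g) (x : ℝ) :
    HasDerivAt (deriv g) (iteratedDeriv 2 g x) x := by
  have h1 : ContDiff ℝ 1 (deriv g) := by
    have := hg.iterate_deriv' 1 1
    simpa using this
  have h2 : HasDerivAt (deriv g) (deriv (deriv g) x) x :=
    ((h1.differentiable (by norm_num)) x).hasDerivAt
  rwa [iteratedDeriv_succ, iteratedDeriv_one]

/-- For a `C²` function, `g''` is continuous. [folklore] -/
private theorem continuous_iteratedDeriv_two_g {g : ℝ → ℂ} (hg : ContDiff ℝ 2 g) :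
    Continuous (iteratedDeriv 2 g) :=
  hg.continuous_iteratedDeriv 2 le_rfl

/-! ## The approximation theorem -/

/-- **Weighted `C²` density of exponential polynomials.** For `g : ℝ → ℂ` of class `C²` with
`g = 0` off `[X₁, X₂]` and `ε > 0`, there are `N` and coefficients `q_k ∈ ℂ` such that
the exponential polynomial `f(x) = Σ_{k<N} q_k e^{-(k+2)x}/(k+2)²`, its derivative
`f'(x) = -Σ_{k<N} q_k e^{-(k+2)x}/(k+2)` and its second derivative `f''(x) = Σ_{k<N} q_k e^{-(k+2)x}`
satisfy `‖f - g‖, ‖f' - g'‖, ‖f'' - g''‖ ≤ ε e^{-2x}` on `[0, ∞)` (`g' = deriv g`,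
`g'' = iteratedDeriv 2 g`); the derivative relations are part of the conclusion. Proof:
Weierstrass' theorem for `t ↦ t^{-2} g''(-log t)` on `[0,1]` (`t = e^{-x}`), then two
integrations from `+∞`. [cite: Rudin1976, Thm 7.26] -/
theorem exists_expPoly_approx {g : ℝ → ℂ} (hg : ContDiff ℝ 2 g) {X₁ X₂ : ℝ}
    (hsupp : ∀ x ∉ Set.Icc X₁ X₂, g x = 0) {ε : ℝ} (hε : 0 < ε) :
    ∃ (N : ℕ) (q : ℕ → ℂ),
      (∀ x : ℝ, HasDerivAt
        (fun x : ℝ => ∑ k ∈ Finset.range N,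
          q k * ((Real.exp (-(((k : ℝ) + 2) * x)) : ℝ) : ℂ) / ((k : ℂ) + 2) ^ 2)
        (-∑ k ∈ Finset.range N,
          q k * ((Real.exp (-(((k : ℝ) + 2) * x)) : ℝ) : ℂ) / ((k : ℂ) + 2)) x) ∧
      (∀ x : ℝ, HasDerivAt
        (fun x : ℝ => -∑ k ∈ Finset.range N,
          q k * ((Real.exp (-(((k : ℝ) + 2) * x)) : ℝ) : ℂ) / ((k : ℂ) + 2))
        (∑ k ∈ Finset.range N, q k * ((Real.exp (-(((k : ℝ) + 2) * x)) : ℝ) : ℂ)) x) ∧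
      Continuous (fun x : ℝ => ∑ k ∈ Finset.range N,
          q k * ((Real.exp (-(((k : ℝ) + 2) * x)) : ℝ) : ℂ)) ∧
      ∀ x : ℝ, 0 ≤ x →
        ‖(∑ k ∈ Finset.range N,
            q k * ((Real.exp (-(((k : ℝ) + 2) * x)) : ℝ) : ℂ) / ((k : ℂ) + 2) ^ 2) - g x‖ ≤
            ε * Real.exp (-(2 * x)) ∧
        ‖(-∑ k ∈ Finset.range N,
            q k * ((Real.exp (-(((k : ℝ) + 2) * x)) : ℝ) : ℂ) / ((k : ℂ) + 2)) - deriv g x‖ ≤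
            ε * Real.exp (-(2 * x)) ∧
        ‖(∑ k ∈ Finset.range N, q k * ((Real.exp (-(((k : ℝ) + 2) * x)) : ℝ) : ℂ)) -
            iteratedDeriv 2 g x‖ ≤ ε * Real.exp (-(2 * x)) := by
  set g'' : ℝ → ℂ := iteratedDeriv 2 g with hg''
  have hg''c : Continuous g'' := continuous_iteratedDeriv_two_g hg
  -- Step 1: `G(t) = t^{-2} g''(-log t)` is continuous on `[0,1]`
  set G : ℝ → ℂ := fun t => g'' (-Real.log t) / ((t : ℂ) ^ 2) with hG
  have hGzero : ∀ t : ℝ, |t| < Real.exp (-X₂) → G t = 0 := by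
    intro t ht
    rcases eq_or_ne t 0 with rfl | ht0
    · simp [hG]
    · have h1 : Real.log |t| < -X₂ := by
        rw [Real.log_lt_iff_lt_exp (abs_pos.mpr ht0)]; exact ht
      rw [Real.log_abs] at h1
      have h2 : X₂ < -Real.log t := by linarith
      have h3 := iteratedDeriv_two_eq_zero_of_gt hsupp h2
      rw [← hg''] at h3
      simp only [hG, h3, zero_div]
  have hGcont : ContinuousOn G (Icc 0 1) := by
    intro t ht
    rcases eq_or_lt_of_le ht.1 with h0 | hpos
    · -- `t = 0`: `G` vanishes near `0`
      rw [← h0]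
      have hev : G =ᶠ[𝓝 0] fun _ => 0 := by
        have : Iio (Real.exp (-X₂)) ∈ 𝓝 (|(0 : ℝ)|) := by
          rw [abs_zero]; exact Iio_mem_nhds (Real.exp_pos _)
        filter_upwards [continuous_abs.continuousAt.preimage_mem_nhds this] with s hs
        exact hGzero s hs
      exact (continuousAt_const.congr (f := fun _ => (0 : ℂ)) hev.symm).continuousWithinAt
    · -- `t > 0`: composition of continuous functions
      have hlog : ContinuousAt Real.log t := Real.continuousAt_log hpos.ne'
      have h1 : ContinuousAt (fun t => g'' (-Real.log t)) t :=
        hg''c.continuousAt.comp hlog.neg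
      have h2 : ContinuousAt (fun t : ℝ => ((t : ℂ) ^ 2)) t := by fun_prop
      have h3 : ((t : ℂ) ^ 2) ≠ 0 := pow_ne_zero _ (Complex.ofReal_ne_zero.mpr hpos.ne')
      exact (h1.div h2 h3).continuousWithinAt
  -- Step 2: Weierstrass for the real and imaginary parts
  have hε2 : 0 < ε / 2 := by linarith
  obtain ⟨P₁, hP₁⟩ := exists_polynomial_near_of_continuousOn 0 1 (fun t => (G t).re)
    (Complex.continuous_re.comp_continuousOn hGcont) (ε / 2) hε2
  obtain ⟨P₂, hP₂⟩ := exists_polynomial_near_of_continuousOn 0 1 (fun t => (G t).im)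
    (Complex.continuous_im.comp_continuousOn hGcont) (ε / 2) hε2
  set N : ℕ := max P₁.natDegree P₂.natDegree + 1 with hN
  set q : ℕ → ℂ := fun k => (P₁.coeff k : ℂ) + (P₂.coeff k : ℂ) * Complex.I with hq
  have hN₁ : P₁.natDegree < N := by omega
  have hN₂ : P₂.natDegree < N := by omega
  have hQ : ∀ t ∈ Icc (0 : ℝ) 1, ‖(∑ k ∈ Finset.range N, q k * (t : ℂ) ^ k) - G t‖ < ε := by
    intro t ht
    have hsum : (∑ k ∈ Finset.range N, q k * (t : ℂ) ^ k) =
        ((P₁.eval t : ℝ) : ℂ) + ((P₂.eval t : ℝ) : ℂ) * Complex.I := by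
      rw [Polynomial.eval_eq_sum_range' hN₁, Polynomial.eval_eq_sum_range' hN₂]
      push_cast
      rw [Finset.sum_mul, ← Finset.sum_add_distrib]
      refine Finset.sum_congr rfl fun k _ => ?_
      simp only [hq]; ring
    rw [hsum]
    have hre : (((P₁.eval t : ℝ) : ℂ) + ((P₂.eval t : ℝ) : ℂ) * Complex.I - G t).re =
        P₁.eval t - (G t).re := by simp
    have him : (((P₁.eval t : ℝ) : ℂ) + ((P₂.eval t : ℝ) : ℂ) * Complex.I - G t).im =
        P₂.eval t - (G t).im := by simp
    calc ‖((P₁.eval t : ℝ) : ℂ) + ((P₂.eval t : ℝ) : ℂ) * Complex.I - G t‖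
        ≤ |(((P₁.eval t : ℝ) : ℂ) + ((P₂.eval t : ℝ) : ℂ) * Complex.I - G t).re| +
          |(((P₁.eval t : ℝ) : ℂ) + ((P₂.eval t : ℝ) : ℂ) * Complex.I - G t).im| :=
          Complex.norm_le_abs_re_add_abs_im _
      _ < ε / 2 + ε / 2 := by rw [hre, him]; exact add_lt_add (hP₁ t ht) (hP₂ t ht)
      _ = ε := by ring
  -- Step 3: the second derivatives: `‖Σ q_k e^{-(k+2)x} - g''(x)‖ ≤ ε e^{-2x}` on `[0,∞)`
  have hD2 : ∀ x : ℝ, 0 ≤ x →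
      ‖(∑ k ∈ Finset.range N, q k * ((Real.exp (-(((k : ℝ) + 2) * x)) : ℝ) : ℂ)) - g'' x‖ ≤
        ε * Real.exp (-(2 * x)) := by
    intro x hx
    set t : ℝ := Real.exp (-x) with ht
    have ht1 : t ∈ Icc (0 : ℝ) 1 :=
      ⟨(Real.exp_pos _).le, by rw [ht]; exact Real.exp_le_one_iff.mpr (by linarith)⟩
    have hexp2 : Real.exp (-(2 * x)) = t ^ 2 := by
      rw [ht, ← Real.exp_nat_mul]; ring_nf
    have hterm : ∀ k : ℕ, ((Real.exp (-(((k : ℝ) + 2) * x)) : ℝ) : ℂ) =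
        ((Real.exp (-(2 * x)) : ℝ) : ℂ) * (t : ℂ) ^ k := by
      intro k
      rw [ht, ← Complex.ofReal_pow, ← Complex.ofReal_mul, ← Real.exp_nat_mul, ← Real.exp_add]
      congr 1; congr 1; ring
    have hG_t : G t = g'' x / ((Real.exp (-(2 * x)) : ℝ) : ℂ) := by
      show g'' (-Real.log t) / ((t : ℂ) ^ 2) = g'' x / ((Real.exp (-(2 * x)) : ℝ) : ℂ)
      rw [hexp2, ht, Real.log_exp, neg_neg]
      push_cast
      rfl
    have hE0 : ((Real.exp (-(2 * x)) : ℝ) : ℂ) ≠ 0 :=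
      Complex.ofReal_ne_zero.mpr (Real.exp_pos _).ne'
    have hfact : (∑ k ∈ Finset.range N, q k * ((Real.exp (-(((k : ℝ) + 2) * x)) : ℝ) : ℂ)) - g'' x =
        ((Real.exp (-(2 * x)) : ℝ) : ℂ) * ((∑ k ∈ Finset.range N, q k * (t : ℂ) ^ k) - G t) := by
      rw [hG_t, mul_sub, mul_div_cancel₀ _ hE0, Finset.mul_sum]
      congr 1
      refine Finset.sum_congr rfl fun k _ => ?_
      rw [hterm k]; ring
    rw [hfact, norm_mul, Complex.norm_real, Real.norm_of_nonneg (Real.exp_pos _).le, mul_comm]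
    exact mul_le_mul_of_nonneg_right (hQ t ht1).le (Real.exp_pos _).le
  -- Step 4: integrate twice from `+∞`
  have hderiv2 := hasDerivAt_expPoly_two N q
  have hderiv1 := hasDerivAt_expPoly_one N q
  have hD1 : ∀ x : ℝ, 0 ≤ x →
      ‖(-∑ k ∈ Finset.range N,
          q k * ((Real.exp (-(((k : ℝ) + 2) * x)) : ℝ) : ℂ) / ((k : ℂ) + 2)) - deriv g x‖ ≤
        ε / 2 * Real.exp (-(2 * x)) := by
    refine norm_le_of_deriv_bound (D' := fun x => (∑ k ∈ Finset.range N,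
        q k * ((Real.exp (-(((k : ℝ) + 2) * x)) : ℝ) : ℂ)) - g'' x)
      (fun x => (hderiv1 x).sub (hasDerivAt_deriv_g hg x))
      ((continuous_expPoly_zero N q).sub hg''c) hD2 ?_
    rw [← sub_zero (0 : ℂ)]
    refine Tendsto.sub ?_ (tendsto_deriv_zero_atTop hsupp)
    rw [← neg_zero, show (0 : ℂ) = ∑ k ∈ Finset.range N, (0 : ℂ) by simp]
    refine (tendsto_finsetSum _ fun k _ => ?_).neg
    have h := tendsto_const_mul_ofReal_exp_neg_mul (q k / ((k : ℂ) + 2)) (a := (k : ℝ) + 2)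
      (by positivity)
    refine h.congr fun x => ?_
    ring
  have hD0 : ∀ x : ℝ, 0 ≤ x →
      ‖(∑ k ∈ Finset.range N,
          q k * ((Real.exp (-(((k : ℝ) + 2) * x)) : ℝ) : ℂ) / ((k : ℂ) + 2) ^ 2) - g x‖ ≤
        ε / 2 / 2 * Real.exp (-(2 * x)) := by
    refine norm_le_of_deriv_bound (D' := fun x => (-∑ k ∈ Finset.range N,
        q k * ((Real.exp (-(((k : ℝ) + 2) * x)) : ℝ) : ℂ) / ((k : ℂ) + 2)) - deriv g x)
      (fun x => (hderiv2 x).sub (hasDerivAt_g hg x)) ?_ hD1 ?_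
    · refine Continuous.sub (Continuous.neg (continuous_finsetSum _ fun k _ => ?_))
        (hg.continuous_deriv (by norm_num))
      exact (continuous_const.mul (Complex.continuous_ofReal.comp (by fun_prop))).div_const _
    · rw [← sub_zero (0 : ℂ)]
      refine Tendsto.sub ?_ (tendsto_zero_atTop hsupp)
      rw [show (0 : ℂ) = ∑ k ∈ Finset.range N, (0 : ℂ) by simp]
      refine tendsto_finsetSum _ fun k _ => ?_
      have h := tendsto_const_mul_ofReal_exp_neg_mul (q k / ((k : ℂ) + 2) ^ 2) (a := (k : ℝ) + 2)
        (by positivity)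
      refine h.congr fun x => ?_
      ring
  refine ⟨N, q, hderiv2, hderiv1, continuous_expPoly_zero N q, fun x hx => ⟨?_, ?_, hD2 x hx⟩⟩
  · have h := hD0 x hx
    have : ε / 2 / 2 * Real.exp (-(2 * x)) ≤ ε * Real.exp (-(2 * x)) := by
      have := Real.exp_pos (-(2 * x)); nlinarith
    linarith
  · have h := hD1 x hx
    have : ε / 2 * Real.exp (-(2 * x)) ≤ ε * Real.exp (-(2 * x)) := by
      have := Real.exp_pos (-(2 * x)); nlinarith
    linarith

end Literature.Analysis.FunctionSpaces

end
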